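import Literature.NumberTheory.EllipticCurves.ModularCurve
import Literature.NumberTheory.EllipticCurves.GlobalMinimalModel
import Literature.NumberTheory.EllipticCurves.GaloisAction
import Literature.NumberTheory.EllipticCurves.SemistabilityDefect
import Literature.NumberTheory.DiophantineGeometry.Conductor
import Literature.NumberTheory.DiophantineGeometry.TateAlgorithm
import Literature.NumberTheory.DiophantineGeometry.KodairaSymbol
import Mathlib.NumberTheory.Padics.HeightOneSpectrum
import HarnessLib
import HarnessLib.Audit.Tags

/-!
# Candidates E-desc-11 / 12 / 13R: the TAME-PACKET TORUS LAWS — inertial and own tori of a tame additive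
# prime divide the optimal degree (`InertialTorusLawTwo`, `InertialTorusLawThree`, `OwnTorusLawR`)
# — cell `bsd-f2-manin` (D-0131 (3) frontier: the Manin constant at additive primes). `@[conjecture]`
# leaf (NOTHING asserted; definitions only).

HONEST FRAMING. LENS = descent / visibility (planner `bsd-f2-manin-desc` g1/g2, HOME
`run/shared/lean/pub/bsd-f2-manin/MEMO-desc.md` §18 «tame packet laws»), Props VERBATIM from
HOME/desc/Sketch-desc-g1.lean 61107beb94eee554 (:381, :399; audited copy HOME/ref1-C12-desc-g2.lean) and, for
the REPAIRED row 13R, HOME/desc/Sketch-desc-g2.lean e73920921086fbd3 :196 (refuter-1's repair C′ of the KILLED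
E-desc-13 `OwnTorusLaw`: false as typed at the CM curve 121b1, `ℓ = 3`, `N = q²`; C′ = «`N ≠ q²` for every
`ℓ`»), with the sketch's helper `ownTorusOrder q e = if e ∣ q − 1 then q − 1 else q + 1` inlined and
`e = W.semistabilityDefectAt q` (tree). DICTIONARY (memo §18): at a TAME additive prime `q` (`q² ∥ N`) with
inertia of order `e`, the *own torus* of the type is the split torus (order `q − 1`) if `e ∣ q − 1` (ramified
principal series) and the non-split torus (order `q + 1`) otherwise (supercuspidal induced from the unramified
quadratic extension); when `ρ̄_{E,ℓ}` is twisted-unipotent at `q` (`ℓ ∣ e⁰` or type `I_n*`) both tori count: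
`ℓ^{v_ℓ(q² − 1)}`.

THE ROWS. E-desc-11 `InertialTorusLawTwo`: optimal `E`, prime `q ≥ 3`, `q² ∥ N`, `N ≠ q²`, type III or III*
at `q`, `E[2]` irreducible ⇒ `2^{v₂(q² − 1)} ∣ deg φ₀`. E-desc-12 `InertialTorusLawThree`: `q² ∥ N`, type II,
II*, IV or IV* at `q`, `E[3]` irreducible ⇒ `3^{v₃(q² − 1)} ∣ deg φ₀`. E-desc-13R `OwnTorusLawR`: `q ≥ 5`,
`q² ∣ N`, `N ≠ q²`, prime `ℓ ≠ q` with `E[ℓ]` irreducible ⇒ `ℓ^{v_ℓ(#T_own)} ∣ deg φ₀`. BC5 WITNESS (memo §18;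
Cremona curve #1, N < 4·10⁵): III/III* with `ℓ = 2`: 61 712 + 57 060 at `q = 3`, 0 violations, tight to
depth 6; II/II*/IV/IV* with `ℓ = 3`: 183 448, 0 violations, tight to depth 4; refuter-1 (§R8.4, pre-audit +
census N < 5·10⁵): 11: 0 / 150 012, 12: 0 / 384 695, 13R: 0 / 1 060 911. Refuter verdicts: REF1 **E-desc-11,
E-desc-12 SURVIVE; E-desc-13 KILLED as typed (refuted-misstated, 121b1) → C′ = 13R** 2026-08-27T17:30Z
(HOME/REFUTER-ref1.md §R8.4); REF2 (LIT-PLACEMENT v5 §C⁵, 17:47Z): «IN PRINT one level up — as congruence-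
ideal / Selmer-length theorems (Diamond–Flach–Guo 2004 Thm 0.2 + Prop 1.12(c)/1.4(c)) — except exactly at
`ℓ = 2` and `ℓ ∣ N`»: E-desc-13R at `ℓ ∤ 2N` and E-desc-12 at `3 ∤ N` are print corollaries; the rows as typed
(including `ℓ = 2`, `ℓ ∣ N`) are NOT in print.
-/

noncomputable section

open scoped MatrixGroups ModularForm

open CongruenceSubgroup WeierstrassCurve
  Literature.NumberTheory.EllipticCurves Literature.NumberTheory.EllipticCurves.ModularForms
  Literature.NumberTheory.DiophantineGeometry

namespace Summit.BirchSwinnertonDyer.Rank1Residual.ManinAdditive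

/-- **Candidate E-desc-11 `InertialTorusLawTwo`** (nothing asserted): optimal `E`, prime `q ≥ 3` with
`q² ∥ N` (tame), `N ≠ q²`, Kodaira type `III` or `III*` at `q` (inertia of order 4), `E[2]` irreducible
⇒ `2 ^ v₂(q² − 1) ∣ deg φ₀`.
[cite: Takahashi2001, Thm 2.3 (p. 6, shape only; the inertial-torus divisibility at a tame additive prime is NOT in print as stated — per refuter-2 v5 §C⁵ its ℓ ∤ 2N part is a corollary of Diamond–Flach–Guo 2004; cell bsd-f2-manin MEMO-desc.md §18, E-desc-11)] -/
@[conjecture] def InertialTorusLawTwo : Prop :=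
  ∀ (W : WeierstrassCurve ℚ) [W.IsElliptic] [W.IsGloballyMinimal] [NeZero (W.conductorNorm ℤ)]
    (D : ModularParametrizationData W (W.conductorNorm ℤ)),
    (∀ z ∈ D.L.lattice, ∃ w ∈ periodLattice D.f, z = D.c * w) →
    (∀ (W' : WeierstrassCurve ℚ) [W'.IsElliptic]
        (D' : ModularParametrizationData W' (W.conductorNorm ℤ)),
        D'.f = D.f → D.modularDegree ≤ D'.modularDegree) →
    ∀ (q : ℕ) (hq : q.Prime), 3 ≤ q → q ^ 2 ∣ W.conductorNorm ℤ → ¬ q ^ 3 ∣ W.conductorNorm ℤ →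
      W.conductorNorm ℤ ≠ q ^ 2 →
      (W.kodairaSymbolAt ((Rat.HeightOneSpectrum.primesEquiv (R := ℤ)).symm ⟨q, hq⟩) =
          KodairaSymbol.III ∨
        W.kodairaSymbolAt ((Rat.HeightOneSpectrum.primesEquiv (R := ℤ)).symm ⟨q, hq⟩) =
          KodairaSymbol.IIIstar) →
      W.HasIrreducibleModPGaloisRep 2 → 2 ^ padicValNat 2 (q ^ 2 - 1) ∣ D.modularDegree
/-- **Candidate E-desc-12 `InertialTorusLawThree`** (nothing asserted): optimal `E`, prime `q` with
`q² ∥ N` (tame; so `q = 2` or `q ≥ 5` for these types), Kodaira type `II`, `II*`, `IV` or `IV*` at `q`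
(inertia of order 3 or 6), `E[3]` irreducible ⇒ `3 ^ v₃(q² − 1) ∣ deg φ₀`.
[cite: Takahashi2001, Thm 2.3 (p. 6, shape only; NOT in print as stated — refuter-2: the 3 ∤ N part is a print corollary (DFG04); cell bsd-f2-manin MEMO-desc.md §18, E-desc-12)] -/
@[conjecture] def InertialTorusLawThree : Prop :=
  ∀ (W : WeierstrassCurve ℚ) [W.IsElliptic] [W.IsGloballyMinimal] [NeZero (W.conductorNorm ℤ)]
    (D : ModularParametrizationData W (W.conductorNorm ℤ)),
    (∀ z ∈ D.L.lattice, ∃ w ∈ periodLattice D.f, z = D.c * w) →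
    (∀ (W' : WeierstrassCurve ℚ) [W'.IsElliptic]
        (D' : ModularParametrizationData W' (W.conductorNorm ℤ)),
        D'.f = D.f → D.modularDegree ≤ D'.modularDegree) →
    ∀ (q : ℕ) (hq : q.Prime), q ^ 2 ∣ W.conductorNorm ℤ → ¬ q ^ 3 ∣ W.conductorNorm ℤ →
      (W.kodairaSymbolAt ((Rat.HeightOneSpectrum.primesEquiv (R := ℤ)).symm ⟨q, hq⟩) =
          KodairaSymbol.II ∨
        W.kodairaSymbolAt ((Rat.HeightOneSpectrum.primesEquiv (R := ℤ)).symm ⟨q, hq⟩) =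
          KodairaSymbol.IIstar ∨
        W.kodairaSymbolAt ((Rat.HeightOneSpectrum.primesEquiv (R := ℤ)).symm ⟨q, hq⟩) =
          KodairaSymbol.IV ∨
        W.kodairaSymbolAt ((Rat.HeightOneSpectrum.primesEquiv (R := ℤ)).symm ⟨q, hq⟩) =
          KodairaSymbol.IVstar) →
      W.HasIrreducibleModPGaloisRep 3 → 3 ^ padicValNat 3 (q ^ 2 - 1) ∣ D.modularDegree

/-- **Candidate E-desc-13R `OwnTorusLawR`** (REPAIRED E-desc-13 after ref1 g2's refutation of the
typed E-desc-13 by 121b1 at ℓ = 3, N = 11²; a CONJECTURE of the cell, nothing asserted): optimal `E`,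
prime `q ≥ 5` with `q² ∣ N` and `N ≠ q²` (for EVERY ℓ — the packet at `M = 1` is incomplete), `e =
semistabilityDefectAt q`, prime `ℓ ≠ q` with `E[ℓ]` irreducible ⇒ `ℓ ^ v_ℓ(#T_own) ∣ deg φ₀`.
ref1's census under this C′: 1 060 911 incidences, 0 violations (N < 5·10⁵).
[cite: DiamondFlachGuo2004, Thm 0.2 with Prop 1.12(c) / 1.4(c) (the ℓ ∤ 2N part, per refuter-2 v5 §C⁵; the row as typed is NOT in print — cell bsd-f2-manin MEMO-desc.md §18, E-desc-13R)] -/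
@[conjecture] def OwnTorusLawR : Prop :=
  ∀ (W : WeierstrassCurve ℚ) [W.IsElliptic] [W.IsGloballyMinimal] [NeZero (W.conductorNorm ℤ)]
    (D : ModularParametrizationData W (W.conductorNorm ℤ)),
    (∀ z ∈ D.L.lattice, ∃ w ∈ periodLattice D.f, z = D.c * w) →
    (∀ (W' : WeierstrassCurve ℚ) [W'.IsElliptic]
        (D' : ModularParametrizationData W' (W.conductorNorm ℤ)),
        D'.f = D.f → D.modularDegree ≤ D'.modularDegree) →
    ∀ (q ℓ : ℕ), q.Prime → 5 ≤ q → q ^ 2 ∣ W.conductorNorm ℤ → W.conductorNorm ℤ ≠ q ^ 2 →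
      ℓ.Prime → ℓ ≠ q → W.HasIrreducibleModPGaloisRep ℓ →
      ℓ ^ padicValNat ℓ (if W.semistabilityDefectAt q ∣ q - 1 then q - 1 else q + 1) ∣ D.modularDegree

end Summit.BirchSwinnertonDyer.Rank1Residual.ManinAdditive

end
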